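import Mathlib
import HarnessLib

/-!
# The FLAT refinement count at fixed prescription: (children per coarse sector)^(number of free legs)

Topic `MathematicalPhysics/QuantumLattice`; companion of `SectorisedKernelNormRefinementPrescribed` (whose hypotheses `hRoff`/`hRon` ask for a bound
on the number of fine sector tuples with PRESCRIBED values on a leg set `E` that refine a given coarse tuple leg by leg).  Benfatto–Giuliani–Mastropietro
2006 §2.8 (2.83)/(2.88)–(2.90): when a kernel of scale `h′` is rewritten in the sectors of a lower scale `h`, each free leg's fine sector must be contained
in (a child of) the coarse one — WITHOUT using momentum conservation this gives the flat count (children per sector)^(free legs), `γ^{(h′−h)(L−|E|)/2}`-type;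
the relative sector counting lemma (App. A3 Lemma A3.1) improves the exponent by the conservation constraint.  The flat count is the correct default row
wherever the improvement is not load-bearing (high degrees of the blocked birth-level tower, cell gate-hubbard-kl K3 engine child clause (E1),
E1-TOWER-BLOCKED §10(a)):

* **`card_filter_prescribed_children_le`** — for a relation `child` with at most `κ` fine children per coarse sector, a leg set `E` with prescribed fine
  values `τ″|_E` and any coarse tuple `σ′`:
  `#{σ″ ∈ A″ : σ″|_E = τ″|_E ∧ ∀ i, child (σ″ i) (σ′ i)} ≤ κ^{(m+1) − |E|}`.

Everything is proved; no definition, no named fact.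

## Sources

G. Benfatto, A. Giuliani, V. Mastropietro, Ann. Henri Poincaré 7 (2006) 809–898, §2.8 (2.83), (2.88)–(2.90), App. A3 Lemma A3.1
[`BenfattoGiulianiMastropietro2006`].
-/

namespace Literature.MathematicalPhysics.QuantumLattice

open Finset

variable {S S'' : Type*} [Fintype S''] [DecidableEq S'']

/-- **The flat refinement count at fixed prescription** (BGM 2006 (2.83)/(2.90) without the conservation improvement of Lemma A3.1): if every coarse
sector `s′` has at most `κ` fine children (`#{s″ : child s″ s′} ≤ κ`), then for every constraint set `A″`, leg set `E` with prescribed fine values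
`τ″|_E`, and coarse tuple `σ′`, the number of `σ″ ∈ A″` with `σ″|_E = τ″|_E` that are leg-wise children of `σ′` is `≤ κ^{(m+1) − |E|}` — one factor `κ`
per FREE leg, the prescribed legs contributing `1`. [cite: BenfattoGiulianiMastropietro2006, §2.8 (2.83) and (2.88)-(2.90)] -/
theorem card_filter_prescribed_children_le {m : ℕ} (child : S'' → S → Prop) [DecidableRel child] {κ : ℕ}
    (hκ : ∀ s' : S, ((univ.filter fun s'' : S'' => child s'' s').card) ≤ κ)
    (A'' : Finset (Fin (m + 1) → S'')) (E : Finset (Fin (m + 1))) (τ'' : Fin (m + 1) → S'') (σ' : Fin (m + 1) → S) :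
    (A''.filter fun σ'' => (∀ e ∈ E, σ'' e = τ'' e) ∧ ∀ i, child (σ'' i) (σ' i)).card ≤ κ ^ ((m + 1) - E.card) := by
  classical
  -- leg by leg: the prescribed legs are pinned to `τ″`, the free legs range over the children of `σ′`
  set t : Fin (m + 1) → Finset S'' := fun i =>
    if i ∈ E then ({τ'' i} : Finset S'').filter (fun s'' => child s'' (σ' i)) else univ.filter fun s'' : S'' => child s'' (σ' i) with ht
  have hsub : (A''.filter fun σ'' => (∀ e ∈ E, σ'' e = τ'' e) ∧ ∀ i, child (σ'' i) (σ' i)) ⊆ Fintype.piFinset t := by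
    intro σ'' hσ''
    rw [Fintype.mem_piFinset]
    intro i
    obtain ⟨_, hE, hch⟩ := mem_filter.1 hσ''
    simp only [ht]
    split_ifs with hi
    · exact mem_filter.2 ⟨mem_singleton.2 (hE i hi), hch i⟩
    · exact mem_filter.2 ⟨mem_univ _, hch i⟩
  have hti : ∀ i, (t i).card ≤ if i ∈ E then 1 else κ := by
    intro i
    simp only [ht]
    split_ifs with hi
    · exact (card_filter_le _ _).trans (card_singleton _).le
    · exact hκ (σ' i)
  calc (A''.filter fun σ'' => (∀ e ∈ E, σ'' e = τ'' e) ∧ ∀ i, child (σ'' i) (σ' i)).card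
      ≤ (Fintype.piFinset t).card := card_le_card hsub
    _ = ∏ i, (t i).card := Fintype.card_piFinset t
    _ ≤ ∏ i, (if i ∈ E then 1 else κ) := prod_le_prod' fun i _ => hti i
    _ = κ ^ ((m + 1) - E.card) := by
        rw [prod_ite, prod_const_one, one_mul, prod_const]
        congr 1
        have hcomp : (univ.filter fun i : Fin (m + 1) => ¬ i ∈ E) = univ \ E := by ext i; simp
        rw [hcomp, card_univ_sdiff, Fintype.card_fin]

/-- **The refinement count with ONE DETERMINED LEG at fixed prescription** (BGM 2006 (2.83), (2.89): momentum conservation fixes the fine sector of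
the last free leg up to a bounded number `D` of choices once the fine sectors of all the other legs are chosen — the first improvement over the flat
count `card_filter_prescribed_children_le`).  Abstract form: if every coarse sector has at most `κ` fine children, `ℓ ∉ E` is a free leg, and for
EVERY assignment `ρ` of fine values the number of fine values `s″` at leg `ℓ` that are children of `σ′ ℓ` with `Function.update ρ ℓ s″ ∈ A″` is at
most `D` (the constraint set `A″` — e.g. the momentum-conserving tuples — determines leg `ℓ` from the others), then
`#{σ″ ∈ A″ : σ″|_E = τ″|_E ∧ ∀ i, child (σ″ i) (σ′ i)} ≤ D · κ^{(m+1) − |E| − 1}` — one factor `κ` per free leg OTHER than `ℓ`.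
[cite: BenfattoGiulianiMastropietro2006, §2.8 (2.83) and (2.88)-(2.90)] -/
theorem card_filter_prescribed_children_lastLeg_le {m : ℕ} (child : S'' → S → Prop) [DecidableRel child] {κ : ℕ}
    (hκ : ∀ s' : S, ((univ.filter fun s'' : S'' => child s'' s').card) ≤ κ)
    (A'' : Finset (Fin (m + 1) → S'')) (E : Finset (Fin (m + 1))) (τ'' : Fin (m + 1) → S'') (σ' : Fin (m + 1) → S)
    {ℓ : Fin (m + 1)} (hℓ : ℓ ∉ E) {D : ℕ}
    (hD : ∀ ρ : Fin (m + 1) → S'', (univ.filter fun s'' : S'' => child s'' (σ' ℓ) ∧ Function.update ρ ℓ s'' ∈ A'').card ≤ D) :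
    (A''.filter fun σ'' => (∀ e ∈ E, σ'' e = τ'' e) ∧ ∀ i, child (σ'' i) (σ' i)).card ≤ D * κ ^ ((m + 1) - E.card - 1) := by
  classical
  -- forget the leg `ℓ`: overwrite it with the fixed value `τ″ ℓ`
  set f : (Fin (m + 1) → S'') → (Fin (m + 1) → S'') := fun σ'' => Function.update σ'' ℓ (τ'' ℓ) with hf
  -- leg by leg: the prescribed legs and `ℓ` are pinned, the other free legs range over the children of `σ′`
  set t : Fin (m + 1) → Finset S'' := fun i =>
    if i ∈ insert ℓ E then ({τ'' i} : Finset S'') else univ.filter fun s'' : S'' => child s'' (σ' i) with ht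
  have hmaps : ∀ σ'' ∈ (A''.filter fun σ'' => (∀ e ∈ E, σ'' e = τ'' e) ∧ ∀ i, child (σ'' i) (σ' i)),
      f σ'' ∈ Fintype.piFinset t := by
    intro σ'' hσ''
    rw [Fintype.mem_piFinset]
    intro i
    obtain ⟨_, hE, hch⟩ := mem_filter.1 hσ''
    simp only [ht, hf]
    split_ifs with hi
    · rw [mem_insert] at hi
      rcases hi with rfl | hi
      · rw [Function.update_self]; exact mem_singleton_self _
      · have hne : i ≠ ℓ := fun h => hℓ (h ▸ hi)
        rw [Function.update_of_ne hne, hE i hi]; exact mem_singleton_self _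
    · have hne : i ≠ ℓ := fun h => hi (h ▸ mem_insert_self _ _)
      rw [Function.update_of_ne hne]; exact mem_filter.2 ⟨mem_univ _, hch i⟩
  -- each fibre of `f` is read off the leg `ℓ`, which the constraint set pins to at most `D` values
  have hfib : ∀ ρ ∈ Fintype.piFinset t,
      ((A''.filter fun σ'' => (∀ e ∈ E, σ'' e = τ'' e) ∧ ∀ i, child (σ'' i) (σ' i)).filter fun σ'' => f σ'' = ρ).card ≤ D := by
    intro ρ _
    refine le_trans (card_le_card_of_injOn (fun σ'' => σ'' ℓ) (fun σ'' hσ'' => ?_) (fun σ₁ h₁ σ₂ h₂ heq => ?_)) (hD ρ)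
    · rw [mem_coe, mem_filter, mem_filter] at hσ''
      obtain ⟨⟨hA, -, hch⟩, hρ⟩ := hσ''
      rw [mem_coe, mem_filter]
      refine ⟨mem_univ _, hch ℓ, ?_⟩
      rw [← hρ, hf, Function.update_idem, Function.update_eq_self]
      exact hA
    · rw [mem_coe, mem_filter] at h₁ h₂
      funext i
      by_cases hi : i = ℓ
      · subst hi; exact heq
      · have h := congrFun (h₁.2.trans h₂.2.symm) i
        simpa only [hf, Function.update_of_ne hi] using h
  have hti : ∀ i, (t i).card ≤ if i ∈ insert ℓ E then 1 else κ := by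
    intro i
    simp only [ht]
    split_ifs with hi
    · exact (card_singleton _).le
    · exact hκ (σ' i)
  have hcardE : (insert ℓ E).card = E.card + 1 := card_insert_of_notMem hℓ
  calc (A''.filter fun σ'' => (∀ e ∈ E, σ'' e = τ'' e) ∧ ∀ i, child (σ'' i) (σ' i)).card
      ≤ D * (Fintype.piFinset t).card := card_le_mul_card_image_of_maps_to hmaps D hfib
    _ = D * ∏ i, (t i).card := by rw [Fintype.card_piFinset t]
    _ ≤ D * ∏ i, (if i ∈ insert ℓ E then 1 else κ) := Nat.mul_le_mul_left D (prod_le_prod' fun i _ => hti i)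
    _ = D * κ ^ ((m + 1) - E.card - 1) := by
        rw [prod_ite, prod_const_one, one_mul, prod_const]
        congr 2
        have hcomp : (univ.filter fun i : Fin (m + 1) => ¬ i ∈ insert ℓ E) = univ \ insert ℓ E := by ext i; simp
        rw [hcomp, card_univ_sdiff, Fintype.card_fin, hcardE]
        omega

end Literature.MathematicalPhysics.QuantumLattice
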